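import Literature.Geometry.GeometricMeasureTheory.RadialProfiles
import Mathlib.Analysis.SpecialFunctions.Log.Deriv
import Mathlib.Analysis.Calculus.Deriv.Inv
import HarnessLib

/-!
# The radial profile weight `F_h(t) = g(½ log t)`, `g' = h`, in the variable `t = ‖z‖²`

For a profile transition `h` at `(s, ε)` (`RadialProfiles.lean`) let `g(x) = ∫_{s-ε}^x h` be its
primitive (`profilePrimitive`: smooth, convex, `= 0` left of `s - ε`, `= x + const` right of
`s + ε`), and define the weight in the variable `t = ‖z‖²`,

`F_h(t) = g(½ log t)` for `t > 0`, `F_h(t) = 0` for `t ≤ 0` (`profileWeight`),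

so that `F_h(‖z‖²) = g(log ‖z‖)` is the smooth radial plurisubharmonic test weight of the theory of
Lelong numbers ([Chirka1989, §15.1]; [Demailly, *Complex analytic and differential geometry*,
Ch. III §5]). This file records its calculus:

* `contDiff_profileWeight` — `F_h` is `C^∞` on `ℝ` (it vanishes on `(-∞, e^{2(s-ε)}]`,
  `profileWeight_eq_zero_of_le`);
* `deriv_profileWeight`, `deriv_deriv_profileWeight` — for `t > 0`:
  `F' = h(½log t)/(2t)`, `F'' = (½h'(½log t) - h(½log t))/(2t²)`; hence `F' ≥ 0` and
  `F' + t F'' = h'/(4t) ≥ 0` (`deriv_profileWeight_nonneg`,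
  `deriv_add_mul_deriv_deriv_profileWeight_nonneg`: Levi-positivity data of `F_h(‖z‖²)`);
* `radial_ma_profileWeight` — the algebraic identity turning the radial Monge–Ampère density
  `p! 4ᵖ F'^{p-1}(F' + F'' τ)` into `p! 2ᵖ t^{-p} (h(x)ᵖ (1 - τ/t) + ½h^{p-1}h'(x) · τ/t)`,
  `x = ½ log t` — the profile integrand of `RadialDensityTauberian.lean`;
* `exists_profileWeight_sub_eq_const` — two profile weights located left of `x₀` differ by a
  constant on `(e^{2x₀}, ∞)` (their differentials agree far out).

## References

* E. M. Chirka, *Complex Analytic Sets*, Kluwer 1989, §15.1 [Chirka1989].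
* J.-P. Demailly, *Complex analytic and differential geometry*, Ch. III §5.
-/

noncomputable section

open Set Filter MeasureTheory intervalIntegral Real
open scoped Topology ContDiff

namespace Literature.Geometry.GeometricMeasureTheory

/-- The **primitive** `g(x) = ∫_{s-ε}^x h` of a profile transition. [cite: Chirka1989, §15.1] -/
def profilePrimitive (h : ℝ → ℝ) (s ε : ℝ) (x : ℝ) : ℝ := ∫ y in (s - ε)..x, h y

/-- The **profile weight** in the variable `t = ‖z‖²`: `F(t) = g(½ log t)` for `t > 0`, `0` for
`t ≤ 0`. [cite: Chirka1989, §15.1] -/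
def profileWeight (h : ℝ → ℝ) (s ε : ℝ) (t : ℝ) : ℝ :=
  if 0 < t then profilePrimitive h s ε (log t / 2) else 0

namespace IsProfileTransition

variable {h : ℝ → ℝ} {s ε : ℝ}

/-! ### The primitive -/

/-- `g' = h`. [folklore] -/
theorem hasDerivAt_profilePrimitive (hh : IsProfileTransition h s ε) (x : ℝ) :
    HasDerivAt (profilePrimitive h s ε) (h x) x :=
  intervalIntegral.integral_hasDerivAt_right
    (hh.contDiff.continuous.intervalIntegrable _ _)
    (hh.contDiff.continuous.stronglyMeasurableAtFilter volume (𝓝 x))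
    hh.contDiff.continuous.continuousAt

/-- `deriv g = h`. [folklore] -/
theorem deriv_profilePrimitive (hh : IsProfileTransition h s ε) :
    deriv (profilePrimitive h s ε) = h :=
  funext fun x => (hh.hasDerivAt_profilePrimitive x).deriv

/-- `g` is differentiable. [folklore] -/
theorem differentiable_profilePrimitive (hh : IsProfileTransition h s ε) :
    Differentiable ℝ (profilePrimitive h s ε) :=
  fun x => (hh.hasDerivAt_profilePrimitive x).differentiableAt

/-- `g` is `C^∞`. [folklore] -/
theorem contDiff_profilePrimitive (hh : IsProfileTransition h s ε) :
    ContDiff ℝ ∞ (profilePrimitive h s ε) :=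
  contDiff_infty_iff_deriv.2 ⟨hh.differentiable_profilePrimitive, by
    rw [hh.deriv_profilePrimitive]; exact hh.contDiff⟩

/-- `g = 0` left of `s - ε`. [folklore] -/
theorem profilePrimitive_eq_zero_of_le (hh : IsProfileTransition h s ε) {x : ℝ} (hx : x ≤ s - ε) :
    profilePrimitive h s ε x = 0 := by
  rw [profilePrimitive, integral_symm, neg_eq_zero]
  rw [integral_congr (g := fun _ => (0 : ℝ)) (fun y hy => ?_), intervalIntegral.integral_zero]
  rw [uIcc_of_le hx] at hy
  exact hh.eq_zero_of_le y hy.2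

/-- `g(x) = x + (g(s+ε) - (s+ε))` right of `s + ε`. [folklore] -/
theorem profilePrimitive_eq_of_le (hh : IsProfileTransition h s ε) {x : ℝ} (hx : s + ε ≤ x) :
    profilePrimitive h s ε x = x + (profilePrimitive h s ε (s + ε) - (s + ε)) := by
  have hint : ∀ a b, IntervalIntegrable h volume a b := fun a b =>
    hh.contDiff.continuous.intervalIntegrable _ _
  rw [profilePrimitive, profilePrimitive, ← integral_add_adjacent_intervals (hint _ (s + ε)) (hint _ x)]
  have h1 : ∫ y in (s + ε)..x, h y = ∫ y in (s + ε)..x, (1 : ℝ) :=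
    integral_congr fun y hy => by
      rw [uIcc_of_le hx] at hy
      exact hh.eq_one_of_le y hy.1
  rw [h1, intervalIntegral.integral_const, smul_eq_mul, mul_one]
  ring

/-- `g ≥ 0`. [folklore] -/
theorem profilePrimitive_nonneg (hh : IsProfileTransition h s ε) (x : ℝ) :
    0 ≤ profilePrimitive h s ε x := by
  rcases le_total x (s - ε) with hx | hx
  · rw [hh.profilePrimitive_eq_zero_of_le hx]
  · exact intervalIntegral.integral_nonneg hx fun y _ => hh.nonneg y

/-! ### The weight `F(t) = g(½ log t)` -/

/-- Unfolding the profile weight at positive arguments. [folklore] -/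
theorem profileWeight_of_pos {t : ℝ} (ht : 0 < t) :
    profileWeight h s ε t = profilePrimitive h s ε (log t / 2) := if_pos ht

/-- The profile weight vanishes at non-positive arguments. [folklore] -/
theorem profileWeight_of_nonpos {t : ℝ} (ht : t ≤ 0) : profileWeight h s ε t = 0 := if_neg (not_lt.2 ht)

/-- `F = 0` on `(-∞, e^{2(s-ε)}]`. [folklore] -/
theorem profileWeight_eq_zero_of_le (hh : IsProfileTransition h s ε) {t : ℝ}
    (ht : t ≤ exp (2 * (s - ε))) : profileWeight h s ε t = 0 := by
  by_cases h0 : 0 < t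
  · rw [profileWeight_of_pos h0]
    apply hh.profilePrimitive_eq_zero_of_le
    have := log_le_log h0 ht
    rw [log_exp] at this
    linarith
  · exact profileWeight_of_nonpos (not_lt.1 h0)

/-- Near a positive `t`, `F = g ∘ (½ log)`. [folklore] -/
theorem profileWeight_eventuallyEq_of_pos {t : ℝ} (ht : 0 < t) :
    profileWeight h s ε =ᶠ[𝓝 t] fun r => profilePrimitive h s ε (log r / 2) := by
  filter_upwards [lt_mem_nhds ht] with r hr using profileWeight_of_pos hr

/-- Near a point `t < e^{2(s-ε)}`, `F = 0`. [folklore] -/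
theorem profileWeight_eventuallyEq_zero (hh : IsProfileTransition h s ε) {t : ℝ}
    (ht : t < exp (2 * (s - ε))) : profileWeight h s ε =ᶠ[𝓝 t] fun _ => 0 := by
  filter_upwards [gt_mem_nhds ht] with r hr using hh.profileWeight_eq_zero_of_le hr.le

/-- **`F` is `C^∞` on `ℝ`.** [folklore] -/
theorem contDiff_profileWeight (hh : IsProfileTransition h s ε) : ContDiff ℝ ∞ (profileWeight h s ε) := by
  rw [contDiff_iff_contDiffAt]
  intro t
  by_cases ht : 0 < t
  · refine ContDiffAt.congr_of_eventuallyEq ?_ (profileWeight_eventuallyEq_of_pos ht)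
    exact hh.contDiff_profilePrimitive.contDiffAt.comp t
      ((contDiffAt_log.2 ht.ne').div_const 2)
  · have ht' : t < exp (2 * (s - ε)) := (not_lt.1 ht).trans_lt (exp_pos _)
    exact contDiffAt_const.congr_of_eventuallyEq (hh.profileWeight_eventuallyEq_zero ht')

/-- **`F'(t) = h(½ log t)/(2t)`** for `t > 0`. [folklore] -/
theorem hasDerivAt_profileWeight (hh : IsProfileTransition h s ε) {t : ℝ} (ht : 0 < t) :
    HasDerivAt (profileWeight h s ε) (h (log t / 2) / (2 * t)) t := by
  have h1 : HasDerivAt (fun r => profilePrimitive h s ε (log r / 2))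
      (h (log t / 2) * (t⁻¹ / 2)) t := by
    have e := (hh.hasDerivAt_profilePrimitive (log t / 2)).comp t ((hasDerivAt_log ht.ne').div_const 2)
    exact e
  refine (h1.congr_of_eventuallyEq (profileWeight_eventuallyEq_of_pos ht)).congr_deriv ?_
  field_simp

/-- `deriv F = h(½ log t)/(2t)` for `t > 0`. [folklore] -/
theorem deriv_profileWeight (hh : IsProfileTransition h s ε) {t : ℝ} (ht : 0 < t) :
    deriv (profileWeight h s ε) t = h (log t / 2) / (2 * t) :=
  (hh.hasDerivAt_profileWeight ht).deriv

/-- Near a positive `t`, `F' = h(½ log ·)/(2 ·)`. [folklore] -/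
theorem deriv_profileWeight_eventuallyEq (hh : IsProfileTransition h s ε) {t : ℝ} (ht : 0 < t) :
    deriv (profileWeight h s ε) =ᶠ[𝓝 t] fun r => h (log r / 2) / (2 * r) := by
  filter_upwards [lt_mem_nhds ht] with r hr using hh.deriv_profileWeight hr

/-- **`F''(t) = (½ h'(½ log t) - h(½ log t))/(2t²)`** for `t > 0`. [folklore] -/
theorem hasDerivAt_deriv_profileWeight (hh : IsProfileTransition h s ε) {t : ℝ} (ht : 0 < t) :
    HasDerivAt (deriv (profileWeight h s ε))
      ((deriv h (log t / 2) / 2 - h (log t / 2)) / (2 * t ^ 2)) t := by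
  have hL : HasDerivAt (fun r => log r / 2) (t⁻¹ / 2) t := (hasDerivAt_log ht.ne').div_const 2
  have hnum : HasDerivAt (fun r => h (log r / 2)) (deriv h (log t / 2) * (t⁻¹ / 2)) t := by
    have e := (hh.hasDerivAt (log t / 2)).comp t hL
    exact e
  have hden : HasDerivAt (fun r : ℝ => 2 * r) 2 t := by
    simpa using (hasDerivAt_id t).const_mul (2 : ℝ)
  have hq := hnum.div hden (by positivity : (2 : ℝ) * t ≠ 0)
  refine (hq.congr_of_eventuallyEq (hh.deriv_profileWeight_eventuallyEq ht)).congr_deriv ?_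
  field_simp

/-- `deriv (deriv F) = (½h' - h)(½ log t)/(2t²)` for `t > 0`. [folklore] -/
theorem deriv_deriv_profileWeight (hh : IsProfileTransition h s ε) {t : ℝ} (ht : 0 < t) :
    deriv (deriv (profileWeight h s ε)) t = (deriv h (log t / 2) / 2 - h (log t / 2)) / (2 * t ^ 2) :=
  (hh.hasDerivAt_deriv_profileWeight ht).deriv

/-- On `(-∞, e^{2(s-ε)})` the weight is locally zero, so `F' = 0` and `F'' = 0` there. [folklore] -/
theorem deriv_profileWeight_eq_zero_of_lt (hh : IsProfileTransition h s ε) {t : ℝ}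
    (ht : t < exp (2 * (s - ε))) : deriv (profileWeight h s ε) t = 0 := by
  rw [(hh.profileWeight_eventuallyEq_zero ht).deriv_eq, deriv_const]

/-- `F'' = 0` left of `e^{2(s-ε)}`. [folklore] -/
theorem deriv_deriv_profileWeight_eq_zero_of_lt (hh : IsProfileTransition h s ε) {t : ℝ}
    (ht : t < exp (2 * (s - ε))) : deriv (deriv (profileWeight h s ε)) t = 0 := by
  have hev : deriv (profileWeight h s ε) =ᶠ[𝓝 t] fun _ => 0 := by
    filter_upwards [gt_mem_nhds ht] with r hr using hh.deriv_profileWeight_eq_zero_of_lt hr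
  rw [hev.deriv_eq, deriv_const]

/-- **`F' ≥ 0`.** [folklore] -/
theorem deriv_profileWeight_nonneg (hh : IsProfileTransition h s ε) (t : ℝ) :
    0 ≤ deriv (profileWeight h s ε) t := by
  by_cases ht : 0 < t
  · rw [hh.deriv_profileWeight ht]
    exact div_nonneg (hh.nonneg _) (by positivity)
  · exact (hh.deriv_profileWeight_eq_zero_of_lt ((not_lt.1 ht).trans_lt (exp_pos _))).symm.le

/-- **`F' + t F'' ≥ 0`** (`= h'(½log t)/(4t)` for `t > 0`): with `F' ≥ 0`, the Levi form of
`F(‖z‖²)`, `2(F'|a|² + F''|⟨a,z⟩|²)`, is non-negative. [folklore] -/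
theorem deriv_add_mul_deriv_deriv_profileWeight_nonneg (hh : IsProfileTransition h s ε) (t : ℝ) :
    0 ≤ deriv (profileWeight h s ε) t + t * deriv (deriv (profileWeight h s ε)) t := by
  by_cases ht : 0 < t
  · rw [hh.deriv_profileWeight ht, hh.deriv_deriv_profileWeight ht]
    have h1 : h (log t / 2) / (2 * t) + t * ((deriv h (log t / 2) / 2 - h (log t / 2)) / (2 * t ^ 2)) =
        deriv h (log t / 2) / (4 * t) := by
      field_simp
      ring
    rw [h1]
    exact div_nonneg (hh.deriv_nonneg _) (by positivity)
  · have ht' : t < exp (2 * (s - ε)) := (not_lt.1 ht).trans_lt (exp_pos _)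
    rw [hh.deriv_profileWeight_eq_zero_of_lt ht', hh.deriv_deriv_profileWeight_eq_zero_of_lt ht']
    simp

/-- **The radial Monge–Ampère density of a profile weight, as a profile integrand**: for `t > 0`,
`p ≥ 1` and any `τ`,
`p! 4ᵖ F'(t)^{p-1} (F'(t) + F''(t) τ) = p! 2ᵖ (tᵖ)⁻¹ (h(x)ᵖ (1 - τ/t) + ½h^{p-1}h'(x) · (τ/t))`,
`x = ½ log t`. With `t = ‖z‖²` and `τ = ‖pr_{T_z} z‖²` the left side is `(dd^c F(‖·‖²))ᵖ` on the
complex frame of the tangent plane (`DDcPowRadial.lean`) and the right side is `p! 2ᵖ` times the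
profile integrand of `RadialDensityTauberian.lean`. [cite: Chirka1989, §15.1] -/
theorem radial_ma_profileWeight (hh : IsProfileTransition h s ε) {p : ℕ} (hp : 1 ≤ p) {t : ℝ}
    (ht : 0 < t) (τ : ℝ) :
    (p.factorial : ℝ) * 4 ^ p * deriv (profileWeight h s ε) t ^ (p - 1) *
        (deriv (profileWeight h s ε) t + deriv (deriv (profileWeight h s ε)) t * τ) =
      (p.factorial : ℝ) * 2 ^ p * (t ^ p)⁻¹ *
        (h (log t / 2) ^ p * (1 - τ / t) + profileKernel h p (log t / 2) * (τ / t)) := by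
  obtain ⟨q, rfl⟩ := Nat.exists_eq_add_of_le' hp
  rw [hh.deriv_profileWeight ht, hh.deriv_deriv_profileWeight ht, profileKernel_def, Nat.add_sub_cancel,
    div_pow, mul_pow, show (4 : ℝ) ^ (q + 1) = 2 ^ (q + 1) * 2 ^ (q + 1) by rw [← mul_pow]; norm_num]
  have ht0 : t ≠ 0 := ht.ne'
  field_simp
  ring

/-- **Two profile weights located left of `x₀` differ by a constant on `(e^{2x₀}, ∞)`.**
[folklore] -/
theorem exists_profileWeight_sub_eq_const {h₁ h₂ : ℝ → ℝ} {s₁ ε₁ s₂ ε₂ x₀ : ℝ}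
    (hh₁ : IsProfileTransition h₁ s₁ ε₁) (hh₂ : IsProfileTransition h₂ s₂ ε₂)
    (hs₁ : s₁ + ε₁ ≤ x₀) (hs₂ : s₂ + ε₂ ≤ x₀) :
    ∃ c : ℝ, ∀ t, exp (2 * x₀) < t → profileWeight h₁ s₁ ε₁ t - profileWeight h₂ s₂ ε₂ t = c := by
  refine ⟨(profilePrimitive h₁ s₁ ε₁ (s₁ + ε₁) - (s₁ + ε₁)) -
    (profilePrimitive h₂ s₂ ε₂ (s₂ + ε₂) - (s₂ + ε₂)), fun t ht => ?_⟩
  have ht0 : 0 < t := (exp_pos _).trans ht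
  have hx : x₀ < log t / 2 := by
    have := log_lt_log (exp_pos _) ht
    rw [log_exp] at this
    linarith
  rw [profileWeight_of_pos ht0, profileWeight_of_pos ht0,
    hh₁.profilePrimitive_eq_of_le (by linarith), hh₂.profilePrimitive_eq_of_le (by linarith)]
  ring

end IsProfileTransition

end Literature.Geometry.GeometricMeasureTheory

end
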